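import Mathlib
import Summits.Ventures.PercRepro.PuncturedLYMMixT4Q1Table1
import Summits.Ventures.PercRepro.PuncturedLYMMixT4Q1Table2

/-!
# PercRepro — (SP) FOR `4` PAIRWISE DISJOINT TRIPLES AND `1` PAIRWISE DISJOINT QUADRUPLES AT LEVEL `4`: POSITIVITY OF THE DENOMINATORS (1)
(p10, gen 41)

`den > 0`, `Pc > 0` for `n ≥ 16`; `Yc > 0` for `n ≥ 5`.  Nothing here asserts (SP).
-/

namespace PercRepro.PuncturedLYM.Split.TypeLift.MixT4Q1

/-- `den > 0` for `n ≥ 16`. -/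
theorem den_pos (n : ℚ) (hn : 16 ≤ n) : 0 < den n := by
  obtain ⟨n', hn', rfl⟩ : ∃ n', 0 ≤ n' ∧ n = 16 + n' := ⟨n - 16, by linarith, by ring⟩
  have h : den (16 + n') = 31104 * n' ^ 15 + 6715872 * n' ^ 14 + 676249776 * n' ^ 13 + 42121197720 * n' ^ 12 + 1814730289164 * n' ^ 11 + 57279365955684 * n' ^ 10 + 1368167263662000 * n' ^ 9 + 25180308649899888 * n' ^ 8 + 359981971347038556 * n' ^ 7 + 3997204168017267732 * n' ^ 6 + 34189038455415636216 * n' ^ 5 + 221188512920174270688 * n' ^ 4 + 1047657830157825475392 * n' ^ 3 + 3429390856616587928256 * n' ^ 2 + 6936537107159664999552 * n' + 6534962235684451238400 := by unfold den; ring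
  rw [h]; positivity

/-- `Yc > 0` for `n ≥ 5`. -/
theorem Yc_pos (n : ℚ) (hn : 5 ≤ n) : 0 < Yc n := by
  obtain ⟨n', hn', rfl⟩ : ∃ n', 0 ≤ n' ∧ n = 5 + n' := ⟨n - 5, by linarith, by ring⟩
  have h : Yc (5 + n') = (1 / 120) * n' ^ 5 + (1 / 8) * n' ^ 4 + (17 / 24) * n' ^ 3 + (15 / 8) * n' ^ 2 + (137 / 60) * n' + 1 := by unfold Yc; ring
  rw [h]; positivity

/-- `Pc > 0` for `n ≥ 16`. -/
theorem Pc_pos (n : ℚ) (hn : 16 ≤ n) : 0 < Pc n := by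
  obtain ⟨n', hn', rfl⟩ : ∃ n', 0 ≤ n' ∧ n = 16 + n' := ⟨n - 16, by linarith, by ring⟩
  have h : Pc (16 + n') = (1 / 24) * n' ^ 4 + (29 / 12) * n' ^ 3 + (1259 / 24) * n' ^ 2 + (6013 / 12) * n' + 1767 := by unfold Pc; ring
  rw [h]; positivity

end PercRepro.PuncturedLYM.Split.TypeLift.MixT4Q1
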